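/-
COR-CM (cell pub-hodgecm2, stage 2 of the Hodge ladder) — RUSH «FULL kernel identification» (operator priority5 2026-08-24T11:43Z (3); PLANNER-A
RSCONJ ROW TABLE r1, row S-d; seat prover-pub-hodgecm2-mukey-p8-g2-0 = mukey-p8): THE S-d SUCCESSOR END = ✔ `D2Bridge/ClosedPrintedMuKeyIdentDelRec.lean`
(p376010, tree bytes sha16 4112e83da6f0e50e) with ONE change of display — the [Liu2021, Thm. 4.18] row `hLiu418` carries, after its face
prefix `(F, h6, ι₁, V, a, Φ, hΦ, ν, hν, hw)`, the IDENTIFICATION BINDER `(R' : RecordSystem F c(V.Hm) ι₁ (conjFrame (frameOf V)) … c(K_f(3)))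
(hR' : c⁻¹(·) ⋙ ℭ.cpt.X = R'.M ∧ ∀ K, ℭ.X (ℭ.levelOf K) = R'.M.obj c(ℭ.levelOf K))` — VERBATIM the conclusion of RSCONJ row R6
`Summit.HodgeConjecture.CorCM.D2Bridge.MuConjIdent.exists_recordSystemConj_X_sec42DataOf_levelOf_eq` (module
`Summits.HodgeConjecture.CorCM.B01.Transposition.HComp.RecordSystemConj`, which proves it from `Model.RecordSystemConj.exists_conj` and ✔
`D2Bridge/MuConjIdentificationSpace.lean` p375975) at the END's objects — and the proof DISCHARGES that binder in kernel (`obtain ⟨R', hR'⟩ := …`)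
before the ONE application of ✔ `MuKeyIdentEnd.hc_cm_of_printed_citations_muKey_ident`.  Every other displayed binder (`hDel ∕ h21 ∕ h411 ∕ h413
∕ hμsep ∕ hD1''`) and the body of `hLiu418` after the prefix are the source bytes of p376010 :66–:112 (nothing retyped); GENERATED by
`HOME/d2bridge/mukey/SUCC-END/mukey-p8/gen_succ_end.py` from the tree file.  THEOREMS ONLY (kernel lane): no `def`, no instance, no `variable`,
no notation, no `sorry`; new declaration name in a new namespace; nothing landed is edited or restated.  FRAMING: HC_CM is NOT proved
unconditionally (the displayed citations are hypotheses); `hμsep` stays the labelled LEG of ✔ p375090 on this edition; the END-of-record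
designation and every reading∕print-instance word are the COORDINATOR's ∕ referees'.  This file claims no pointer ∕ label ∕ count move.
-/
import Summits.HodgeConjecture.CorCM.D2Bridge.ClosedPrintedMuKeyIdent
import Summits.HodgeConjecture.CorCM.DelRec.RecordSystemOfPrinted
import Summits.HodgeConjecture.CorCM.B01.Transposition.HComp.RecordSystemConj
import HarnessLib

/-!
# S-d SUCCESSOR END: `HC_CM` from the printed citations — [Liu2021, Thm. 4.18] at the printed datum UNDER the conjugate-record identification binder, discharged in kernel by RSCONJ

[Liu2021] Y. Liu, *Fourier–Jacobi cycles and arithmetic relative trace formula*, Camb. J. Math. **9** (2021) = arXiv:2102.11518 (`FJcycle.tex`).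

* `hc_cm_of_printed_citations_muKeyIdent_delRec_conj` — DISPLAY (7): `hDel` [Deligne1979, 2.2.5 + Cor. 2.7.21 AS PRINTED, row L1
  `Literature/AlgebraicGeometry/ShimuraVarieties/UnitaryShimuraCanonicalModelPrinted.lean`] · `h21` [Shimura1998 Thm 21.4] · `hLiu418` [Liu2021 Thm 4.18]
  AS PRINTED at `D_print(a, ν) = toThm418Data ℭ (𝒯.restOne (AlgHom.id ℚ _) ι₁ hν hw 𝒞(ν) 𝕌(a).Eps (e ↦ 𝕌(a).epsOf (-e)) 𝕌(a).Chi (𝕌(a).omega νᶜ) (𝕌(a).rho νᶜ))`,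
  `ℭ := sec42DataOf (exists_recordSystem_of_printed hDel) isoOf F ι₁ V Φ` — the statement bytes of ✔ p375902 ∕ p376010 — quantified additionally
  over `(R', hR')`: a Deligne record `R'` of the CONJUGATE hermitian space `c(V.Hm) = (V.Hm)ᵢⱼ ↦ c̄(V.Hm)ᵢⱼ` along the SAME embedding `ι₁`
  with frame `conjFrame (frameOf V)` below the threshold `c(K_f(3))`, and the identification `hR'` of the datum's compactified tower with
  `R'.M` re-indexed along `K ↦ c(K)` (functor level and at every `ℭ.levelOf K`) — the printed §4.2 standing «`X_K := S̃h(𝕍)_K` … smooth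
  projective over the reflex field» (ll. 2062–2066; App. C l. 4656) read for the space `(c(V), ι₁)`, as an EXPLICIT hypothesis of the row rather
  than a rider · `h411` [Def 4.11] · `h413` [Prop 4.13] · `hμsep` [Lem D.1 (3)] · `hD1''` [Lem D.1 (1)] — the last four and `hDel`, `h21`
  VERBATIM the rows of ✔ p376010.  KERNEL: the binder is INHABITED at every face by RSCONJ row R6
  `MuConjIdent.exists_recordSystemConj_X_sec42DataOf_levelOf_eq` (whose proof is `exists_conjRecord_X_sec42DataOf_levelOf_eq … (Model.RecordSystemConj.exists_conj (recordOf …))`,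
  ✔ p375975 + R10), then ✔ `MuKeyIdentEnd.hc_cm_of_printed_citations_muKey_ident`.  No `hLiuC ∕ hLiu ∕ hD1 ∕ hHom ∕ data` row displayed.

Conventions of record (k1)–(k4) and the orientation remark of ✔ `ClosedPrintedMuKeyIdent.lean` :37–:58 apply verbatim to the scalar-keyed rows.
Thm 4.18 row of THIS file: the space identification ‹ℭ.X = the canonical model of (c(V), ι₁)› that ✔ p375902's header carried as DESK RIDER ∕ by-name
reduction is here a DISPLAYED HYPOTHESIS of the row, discharged in the kernel term; what remains of the r8 ∕ (iv-c) wording is for d2bridge-ref ∕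
cite-1 to say on these bytes — this file asserts nothing about it.

HELD — WORLD = C FINAL.  HC_CM is NOT proved unconditionally; nothing displayed is inhabited here except the identification binder (by R10);
whether this file is an END ∕ successor of record is the COORDINATOR's ∕ referees' ∕ auditors' call, not this file's.
[Deligne1979ShimuraVarieties] 2.1.2–2.1.4, 2.2.4–2.2.5, Cor. 2.7.21; [Milne2005ShimuraVarieties] Def. 12.8 (62), Def. 12.10; [Liu2021] §4.2, Thm. 4.18, App. C.
-/

set_option autoImplicit false

noncomputable section

namespace Summit.HodgeConjecture.CorCM.D2Bridge.MuKeyIdentEndDelRecConj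

open scoped TensorProduct Matrix
open NumberField NumberField.InfinitePlace
open HodgeCM.Model HodgeCM.Model.LiuIndex HodgeCM.Model.TowerCarrier
open HodgeCM.Literature.Theta.LiuAlbaneseModuleDatum.D2Bridge (HcmPieces)
open Summit.HodgeConjecture.CorCM.Model
open Literature.AlgebraicGeometry.Motives (CMType)
open Literature.AlgebraicGeometry.HodgeTheory Literature.NumberTheory.Automorphic.PicardCM
open Literature.AlgebraicGeometry.ShimuraVarieties.UnitaryCanonicalModel
open Literature.NumberTheory.ComplexMultiplication
open Literature.NumberTheory.Automorphic
open Literature.NumberTheory.Automorphic.IdeleClassGroup (toHeckeCharacter isUnitary_toHeckeCharacter galConj)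
open Literature.NumberTheory.Automorphic.Liu2021 Literature.NumberTheory.Automorphic.Liu2021.AppendixC
open Literature.NumberTheory.Automorphic.Liu2021.AppendixC.RestOne
open Literature.NumberTheory.Automorphic.Liu2021.Def411WeilCarriers (lineOf locF Rep)
open Summit.HodgeConjecture.CorCM.Transposition.OmegaTransport (realUnit)
open HodgeCM.Model.ArchSideTerm (e₁)
open Literature.NumberTheory.GelbartRogawski1991 Literature.NumberTheory.GelbartRogawski1991.UnitaryDualPair
open Literature.NumberTheory.GelbartRogawski1991.UnitaryDualPair.LocalSplitting (localMu norm_localMu continuous_localMu localMu_toLocalRing_eq_one_iff)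
open Literature.RepresentationTheory Literature.RepresentationTheory.Liu2021
open Summit.HodgeConjecture.CorCM.Transposition
open Summit.HodgeConjecture.CorCM.D2Bridge.AdapterMuConj (muConj prop413AsPrinted_muConj def411_muConj nontrivial_omegaAt_muConj_rest)
open Summit.HodgeConjecture.CorCM.D2Bridge.MuKeyEnd (hc_cm_of_printed_citations_muKey)
open Summit.HodgeConjecture.CorCM.D2Bridge.MuKeyIdentEnd

/-! ## The END with the Deligne record split AND the identification binder: `hLiu418` holds for the §4.2 datum GIVEN its conjugate-record identification, discharged in kernel -/

set_option synthInstance.maxHeartbeats 400000 in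
set_option maxHeartbeats 8000000 in
/-- **S-d SUCCESSOR END — `HC_CM` FROM THE PRINTED CITATIONS, [Liu2021, Thm. 4.18] displayed at the PRINTED datum UNDER AN EXPLICIT
IDENTIFICATION BINDER, the binder DISCHARGED IN KERNEL by RSCONJ.**  Displayed (7): `hDel` [Deligne 1979, 2.2.5 + Cor. 2.7.21 AS PRINTED]
· `h21` [Shimura 1998, Thm. 21.4] · `hLiu418` = [Liu 2021, Thm. 4.18] AS PRINTED at the printed datum `D_print(a, ν)` of ✔ `ClosedPrintedMuKeyIdent`
(p375902) ∕ ✔ `ClosedPrintedMuKeyIdentDelRec` (p376010) — SAME statement bytes — but asked ONLY for §4.2 data `ℭ = sec42DataOf … V Φ` that come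
WITH a Deligne record `R'` ([Deligne 1979] 2.1.2–2.2.5 as typed in `UnitaryCanonicalModel.RecordSystem`) of the CONJUGATE hermitian space
`c(V.Hm)` along the SAME `ι₁` (frame `conjFrame (frameOf V)`, threshold `c(K_f(3))`) and the identification `hR'`: «`c⁻¹(·) ⋙ ℭ.cpt.X = R'.M`
and `ℭ.X_{levelOf K} = R'.M_{c(levelOf K)}` for every level `K`» — i.e. Thm. 4.18 is displayed for the tower `X_K` CERTIFIED to be the
canonical model of `(c(V), ι₁)` (Liu's `X_K = Sh(𝕍)_K`, §4.2 l. 2062, App. C l. 4656), not for a bare model-built tower; the pair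
`(R', hR')` is VERBATIM the conclusion of ✔∕⊢ `MuConjIdent.exists_recordSystemConj_X_sec42DataOf_levelOf_eq` (module
`HComp.RecordSystemConj`, RSCONJ row R6, resting on `Model.RecordSystemConj.exists_conj`) at the END's objects · `h411` [Def. 4.11] · `h413`
[Prop. 4.13] · `hμsep` [Lem. D.1 (3), cross-`μ` LEG — unchanged on this edition] · `hD1''` [Lem. D.1 (1)] — rows 1, 2, 4–7 BYTE-IDENTICAL to
✔ p376010.  KERNEL: for every face, `obtain ⟨R', hR'⟩ := MuConjIdent.exists_recordSystemConj_X_sec42DataOf_levelOf_eq (exists_recordSystem_of_printed hDel) V Φ isoOf h6`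
and feed `hLiu418 … R' hR'`; then ONE application of ✔ `MuKeyIdentEnd.hc_cm_of_printed_citations_muKey_ident`.  No reading of [Liu2021] is
invoked by this file; whether the displayed `hLiu418` is «PRINT INSTANCE modulo kernel identification» is the referees' call (d2bridge-ref ∕
cite-1), not this file's.  HC_CM is NOT proved unconditionally: the seven displayed citations are hypotheses.
[cite: Liu2021, Thm. 4.18 (FJcycle.tex l. 2232–2245), §4.2 (ll. 2053–2074), Rem. 4.4, Def. 4.11, Def. 4.12, Prop. 4.13, Def. 4.16, App. C §C.1 and Prop. C.5 (ll. 4575–4633, 4656), App. D Lem. D.1 (1),(3)]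
[cite: Deligne1979ShimuraVarieties, §2.1.2–2.1.4, 2.2.4–2.2.5 and Cor. 2.7.21] [cite: Milne2005ShimuraVarieties, Def. 12.8 (62), Def. 12.10]
[cite: Shimura1998, §21.4 Thm. 21.4] [cite: GelbartRogawski1991, §3.1 Prop. 3.1.1] -/
theorem hc_cm_of_printed_citations_muKeyIdent_delRec_conj
    (hDel : Literature.AlgebraicGeometry.ShimuraVarieties.UnitaryCanonicalModel.canonicalModel_exists_printed)
    (h21 : shimura1998_thm21_4_casselman)
    -- [Liu21, Thm 4.18] AS PRINTED at the PRINTED datum D_print(a, ν), UNDER THE IDENTIFICATION BINDER (R', hR') = the conclusion of R10's `MuConjIdent.exists_recordSystemConj_X_sec42DataOf_levelOf_eq` VERBATIM (R' a Deligne record of the CONJUGATE space c(V) along ι₁; hR' : the datum's tower IS R'.M re-indexed along c)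
    (hLiu418 : ∀ (F : HodgeCM.CMField) [IsGalois ℚ F] (h6 : 6 ≤ Module.finrank ℚ F) {ι₁ : F →+* ℂ} (V : HodgeCM.HermSpace3 F ι₁) (a : RealScalar F)
      (Φ : CMType F) (hΦ : ι₁ ∈ Φ.1) (ν : Literature.NumberTheory.Automorphic.IdeleClassGroup (F : Type) →ₜ* Circle)
      (hν : IdeleClassGroup.IsConjugateSymplectic (F : Type) ν) (hw : IdeleClassGroup.HasWeight (F : Type) ν 1)
      (R' : RecordSystem (HodgeCM.CMField.K F) (Summit.HodgeConjecture.CorCM.Model.RecordSystemConj.conjGram (HodgeCM.CMField.K F) (HodgeCM.HermSpace3.Hm V)) ι₁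
        (Summit.HodgeConjecture.CorCM.Model.RecordSystemConj.conjFrame (Summit.HodgeConjecture.CorCM.Model.frameOf (⟨HodgeCM.HermSpace3.Hm V, HodgeCM.HermSpace3.isHermitian V, HodgeCM.HermSpace3.signature_ι₁ V, HodgeCM.HermSpace3.posDef_of_ne V⟩ : Summit.HodgeConjecture.CorCM.HermSpace3 ⟨HodgeCM.CMField.K F⟩ ι₁)))
        (Summit.HodgeConjecture.CorCM.Model.RecordSystemConj.formCongr_conjFrame (HodgeCM.CMField.K F) (HodgeCM.HermSpace3.Hm V) ι₁ (Summit.HodgeConjecture.CorCM.Model.frameOf (⟨HodgeCM.HermSpace3.Hm V, HodgeCM.HermSpace3.isHermitian V, HodgeCM.HermSpace3.signature_ι₁ V, HodgeCM.HermSpace3.posDef_of_ne V⟩ : Summit.HodgeConjecture.CorCM.HermSpace3 ⟨HodgeCM.CMField.K F⟩ ι₁))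
          (Summit.HodgeConjecture.CorCM.Model.formCongr_frameOf (⟨HodgeCM.HermSpace3.Hm V, HodgeCM.HermSpace3.isHermitian V, HodgeCM.HermSpace3.signature_ι₁ V, HodgeCM.HermSpace3.posDef_of_ne V⟩ : Summit.HodgeConjecture.CorCM.HermSpace3 ⟨HodgeCM.CMField.K F⟩ ι₁)))
        (Summit.HodgeConjecture.CorCM.Model.RecordSystemConj.conjLevel₀ (HodgeCM.CMField.K F) (HodgeCM.HermSpace3.Hm V) (Summit.HodgeConjecture.CorCM.HComp.K3 (⟨HodgeCM.HermSpace3.Hm V, HodgeCM.HermSpace3.isHermitian V, HodgeCM.HermSpace3.signature_ι₁ V, HodgeCM.HermSpace3.posDef_of_ne V⟩ : Summit.HodgeConjecture.CorCM.HermSpace3 ⟨HodgeCM.CMField.K F⟩ ι₁))))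
      (hR' : CategoryTheory.Functor.comp (Summit.HodgeConjecture.CorCM.Model.RecordSystemConj.smallLevelConjBack (HodgeCM.CMField.K F) (HodgeCM.HermSpace3.Hm V) (Summit.HodgeConjecture.CorCM.HComp.K3 (⟨HodgeCM.HermSpace3.Hm V, HodgeCM.HermSpace3.isHermitian V, HodgeCM.HermSpace3.signature_ι₁ V, HodgeCM.HermSpace3.posDef_of_ne V⟩ : Summit.HodgeConjecture.CorCM.HermSpace3 ⟨HodgeCM.CMField.K F⟩ ι₁))) (Summit.HodgeConjecture.CorCM.Model.sec42DataOfFourLe (Summit.HodgeConjecture.CorCM.DelRec.exists_recordSystem_of_printed hDel) (⟨HodgeCM.HermSpace3.Hm V, HodgeCM.HermSpace3.isHermitian V, HodgeCM.HermSpace3.signature_ι₁ V, HodgeCM.HermSpace3.posDef_of_ne V⟩ : Summit.HodgeConjecture.CorCM.HermSpace3 ⟨HodgeCM.CMField.K F⟩ ι₁) Φ (le_trans (Nat.le_of_ble_eq_true rfl) h6) (isoOf ⟨HodgeCM.CMField.K F⟩ ι₁ (⟨HodgeCM.HermSpace3.Hm V, HodgeCM.HermSpace3.isHermitian V, HodgeCM.HermSpace3.signature_ι₁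 V, HodgeCM.HermSpace3.posDef_of_ne V⟩ : Summit.HodgeConjecture.CorCM.HermSpace3 ⟨HodgeCM.CMField.K F⟩ ι₁) Φ)).cpt.X = R'.M ∧
        ∀ K : Subgroup (Summit.HodgeConjecture.CorCM.Model.honestP5Of (Summit.HodgeConjecture.CorCM.DelRec.exists_recordSystem_of_printed hDel) ⟨HodgeCM.CMField.K F⟩ ι₁ ⟨HodgeCM.HermSpace3.Hm V, HodgeCM.HermSpace3.isHermitian V, HodgeCM.HermSpace3.signature_ι₁ V, HodgeCM.HermSpace3.posDef_of_ne V⟩ Φ).G,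
          (sec42DataOf (Summit.HodgeConjecture.CorCM.DelRec.exists_recordSystem_of_printed hDel) isoOf ⟨HodgeCM.CMField.K F⟩ ι₁ ⟨HodgeCM.HermSpace3.Hm V, HodgeCM.HermSpace3.isHermitian V, HodgeCM.HermSpace3.signature_ι₁ V, HodgeCM.HermSpace3.posDef_of_ne V⟩ Φ).X ((sec42DataOf (Summit.HodgeConjecture.CorCM.DelRec.exists_recordSystem_of_printed hDel) isoOf ⟨HodgeCM.CMField.K F⟩ ι₁ ⟨HodgeCM.HermSpace3.Hm V, HodgeCM.HermSpace3.isHermitian V, HodgeCM.HermSpace3.signature_ι₁ V, HodgeCM.HermSpace3.posDef_of_ne V⟩ Φ).levelOf K) =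
            R'.M.obj (⟨C5.OpenCompactSubgroup.transport (Summit.HodgeConjecture.CorCM.Model.RecordSystemConj.groupConj (HodgeCM.CMField.K F) (HodgeCM.HermSpace3.Hm V)) ((Summit.HodgeConjecture.CorCM.Model.sec42DataOfFourLe (Summit.HodgeConjecture.CorCM.DelRec.exists_recordSystem_of_printed hDel) (⟨HodgeCM.HermSpace3.Hm V, HodgeCM.HermSpace3.isHermitian V, HodgeCM.HermSpace3.signature_ι₁ V, HodgeCM.HermSpace3.posDef_of_ne V⟩ : Summit.HodgeConjecture.CorCM.HermSpace3 ⟨HodgeCM.CMField.K F⟩ ι₁) Φ (le_trans (Nat.le_of_ble_eq_true rfl) h6) (isoOf ⟨HodgeCM.CMField.K F⟩ ι₁ (⟨HodgeCM.HermSpace3.Hm V, HodgeCM.HermSpace3.isHermitian V, HodgeCM.HermSpace3.signature_ι₁ V, HodgeCM.HermSpace3.posDef_of_ne V⟩ : Summit.HodgeConjecture.CorCM.HermSpace3 ⟨HodgeCM.CMField.K F⟩ ι₁) Φ)).levelOf K).1,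
              C5.OpenCompactSubgroup.transport_mono (Summit.HodgeConjecture.CorCM.Model.RecordSystemConj.groupConj (HodgeCM.CMField.K F) (HodgeCM.HermSpace3.Hm V)) ((Summit.HodgeConjecture.CorCM.Model.sec42DataOfFourLe (Summit.HodgeConjecture.CorCM.DelRec.exists_recordSystem_of_printed hDel) (⟨HodgeCM.HermSpace3.Hm V, HodgeCM.HermSpace3.isHermitian V, HodgeCM.HermSpace3.signature_ι₁ V, HodgeCM.HermSpace3.posDef_of_ne V⟩ : Summit.HodgeConjecture.CorCM.HermSpace3 ⟨HodgeCM.CMField.K F⟩ ι₁) Φ (le_trans (Nat.le_of_ble_eq_true rfl) h6) (isoOf ⟨HodgeCM.CMField.K F⟩ ι₁ (⟨HodgeCM.HermSpace3.Hm V, HodgeCM.HermSpace3.isHermitian V, HodgeCM.HermSpace3.signature_ι₁ V, HodgeCM.HermSpace3.posDef_of_ne V⟩ : Summit.HodgeConjecture.CorCM.HermSpace3 ⟨HodgeCM.CMField.K F⟩ ι₁) Φ)).levelOf K).2⟩ :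
              C5.SmallLevel (Summit.HodgeConjecture.CorCM.Model.RecordSystemConj.conjLevel₀ (HodgeCM.CMField.K F) (HodgeCM.HermSpace3.Hm V) (Summit.HodgeConjecture.CorCM.HComp.K3 (⟨HodgeCM.HermSpace3.Hm V, HodgeCM.HermSpace3.isHermitian V, HodgeCM.HermSpace3.signature_ι₁ V, HodgeCM.HermSpace3.posDef_of_ne V⟩ : Summit.HodgeConjecture.CorCM.HermSpace3 ⟨HodgeCM.CMField.K F⟩ ι₁))))),
      Thm418AsPrinted (toThm418Data (sec42DataOf (Summit.HodgeConjecture.CorCM.DelRec.exists_recordSystem_of_printed hDel) isoOf ⟨HodgeCM.CMField.K F⟩ ι₁ ⟨HodgeCM.HermSpace3.Hm V, HodgeCM.HermSpace3.isHermitian V, HodgeCM.HermSpace3.signature_ι₁ V, HodgeCM.HermSpace3.posDef_of_ne V⟩ Φ)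
        ((heckeTranslatesFamilyOf heckeTranslate_definedOver_holds (Summit.HodgeConjecture.CorCM.DelRec.exists_recordSystem_of_printed hDel) isoOf ⟨HodgeCM.CMField.K F⟩ ι₁ ⟨HodgeCM.HermSpace3.Hm V, HodgeCM.HermSpace3.isHermitian V, HodgeCM.HermSpace3.signature_ι₁ V, HodgeCM.HermSpace3.posDef_of_ne V⟩ Φ h6).restOne (AlgHom.id ℚ _) ι₁ hν hw (Def45.Carriers.ofPolDR ν (Def45.PolDR ι₁ hν (Def45.RMuForm ι₁ hν)))
        (uniformOmegaRep (Summit.HodgeConjecture.CorCM.DelRec.exists_recordSystem_of_printed hDel) ⟨HodgeCM.CMField.K F⟩ ι₁ ⟨HodgeCM.HermSpace3.Hm V, HodgeCM.HermSpace3.isHermitian V, HodgeCM.HermSpace3.signature_ι₁ V, HodgeCM.HermSpace3.posDef_of_ne V⟩ Φ e₁ (frameD V) (frameD_real V) (frameD_ne V) (ιVE V) (2 * imagUnit (HodgeCM.CMField.K F))⁻¹ (fun _ _ => (Rep.update ↥(maximalRealSubfield (HodgeCM.CMField.K F)) (imagUnitSq (HodgeCM.CMField.K F)) (Rep.ofLineOf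 ↥(maximalRealSubfield (HodgeCM.CMField.K F)) (imagUnitSq (HodgeCM.CMField.K F))) (locF ↥(maximalRealSubfield (HodgeCM.CMField.K F)) (imagUnitSq (HodgeCM.CMField.K F)) (realUnit ⟨HodgeCM.CMField.K F⟩ a.1 a.2.1 a.2.2)) (realUnit ⟨HodgeCM.CMField.K F⟩ a.1 a.2.1 a.2.2) rfl))).Eps
        (fun e => (uniformOmegaRep (Summit.HodgeConjecture.CorCM.DelRec.exists_recordSystem_of_printed hDel) ⟨HodgeCM.CMField.K F⟩ ι₁ ⟨HodgeCM.HermSpace3.Hm V, HodgeCM.HermSpace3.isHermitian V, HodgeCM.HermSpace3.signature_ι₁ V, HodgeCM.HermSpace3.posDef_of_ne V⟩ Φ e₁ (frameD V) (frameD_real V) (frameD_ne V) (ιVE V) (2 * imagUnit (HodgeCM.CMField.K F))⁻¹ (fun _ _ => (Rep.update ↥(maximalRealSubfield (HodgeCM.CMField.K F)) (imagUnitSq (HodgeCM.CMField.K F)) (Rep.ofLineOf ↥(maximalRealSubfield (HodgeCM.CMField.K F)) (imagUnitSq (HodgeCM.CMField.K F))) (locF ↥(maximalRealSubfield (HodgeCM.CMField.K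 F)) (imagUnitSq (HodgeCM.CMField.K F)) (realUnit ⟨HodgeCM.CMField.K F⟩ a.1 a.2.1 a.2.2)) (realUnit ⟨HodgeCM.CMField.K F⟩ a.1 a.2.1 a.2.2) rfl))).epsOf (-e))
        (uniformOmegaRep (Summit.HodgeConjecture.CorCM.DelRec.exists_recordSystem_of_printed hDel) ⟨HodgeCM.CMField.K F⟩ ι₁ ⟨HodgeCM.HermSpace3.Hm V, HodgeCM.HermSpace3.isHermitian V, HodgeCM.HermSpace3.signature_ι₁ V, HodgeCM.HermSpace3.posDef_of_ne V⟩ Φ e₁ (frameD V) (frameD_real V) (frameD_ne V) (ιVE V) (2 * imagUnit (HodgeCM.CMField.K F))⁻¹ (fun _ _ => (Rep.update ↥(maximalRealSubfield (HodgeCM.CMField.K F)) (imagUnitSq (HodgeCM.CMField.K F)) (Rep.ofLineOf ↥(maximalRealSubfield (HodgeCM.CMField.K F)) (imagUnitSq (HodgeCM.CMField.K F))) (locF ↥(maximalRealSubfield (HodgeCM.CMField.K F)) (imagUnitSq (HodgeCM.CMField.K F)) (realUnit ⟨HodgeCM.CMField.K F⟩ a.1 a.2.1 a.2.2)) (realUnit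 ⟨HodgeCM.CMField.K F⟩ a.1 a.2.1 a.2.2) rfl))).Chi
        ((uniformOmegaRep (Summit.HodgeConjecture.CorCM.DelRec.exists_recordSystem_of_printed hDel) ⟨HodgeCM.CMField.K F⟩ ι₁ ⟨HodgeCM.HermSpace3.Hm V, HodgeCM.HermSpace3.isHermitian V, HodgeCM.HermSpace3.signature_ι₁ V, HodgeCM.HermSpace3.posDef_of_ne V⟩ Φ e₁ (frameD V) (frameD_real V) (frameD_ne V) (ιVE V) (2 * imagUnit (HodgeCM.CMField.K F))⁻¹ (fun _ _ => (Rep.update ↥(maximalRealSubfield (HodgeCM.CMField.K F)) (imagUnitSq (HodgeCM.CMField.K F)) (Rep.ofLineOf ↥(maximalRealSubfield (HodgeCM.CMField.K F)) (imagUnitSq (HodgeCM.CMField.K F))) (locF ↥(maximalRealSubfield (HodgeCM.CMField.K F)) (imagUnitSq (HodgeCM.CMField.K F)) (realUnit ⟨HodgeCM.CMField.K F⟩ a.1 a.2.1 a.2.2)) (realUnit ⟨HodgeCM.CMField.K F⟩ a.1 a.2.1 a.2.2) rfl))).omega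
        (galConj (IsCMField.complexConj _) ν) hν.galConj)
        ((uniformOmegaRep (Summit.HodgeConjecture.CorCM.DelRec.exists_recordSystem_of_printed hDel) ⟨HodgeCM.CMField.K F⟩ ι₁ ⟨HodgeCM.HermSpace3.Hm V, HodgeCM.HermSpace3.isHermitian V, HodgeCM.HermSpace3.signature_ι₁ V, HodgeCM.HermSpace3.posDef_of_ne V⟩ Φ e₁ (frameD V) (frameD_real V) (frameD_ne V) (ιVE V) (2 * imagUnit (HodgeCM.CMField.K F))⁻¹ (fun _ _ => (Rep.update ↥(maximalRealSubfield (HodgeCM.CMField.K F)) (imagUnitSq (HodgeCM.CMField.K F)) (Rep.ofLineOf ↥(maximalRealSubfield (HodgeCM.CMField.K F)) (imagUnitSq (HodgeCM.CMField.K F))) (locF ↥(maximalRealSubfield (HodgeCM.CMField.K F)) (imagUnitSq (HodgeCM.CMField.K F)) (realUnit ⟨HodgeCM.CMField.K F⟩ a.1 a.2.1 a.2.2)) (realUnit ⟨HodgeCM.CMField.K F⟩ a.1 a.2.1 a.2.2) rfl))).rho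
        (galConj (IsCMField.complexConj _) ν) hν.galConj))))
    -- [Liu21, Def 4.11] ∕ [Prop 4.13] ∕ [Lem D.1 (3)] ∕ [Lem D.1 (1)] — VERBATIM the rows of ✔ `MuKeyEnd.hc_cm_of_printed_citations_muKey` (p375090)
    (h411 : ∀ (F : HodgeCM.CMField) [IsGalois ℚ F] (h6 : 6 ≤ Module.finrank ℚ F) {ι₁ : F →+* ℂ} (V : HodgeCM.HermSpace3 F ι₁) (a : RealScalar F)
      (Φ : CMType F) (hΦ : ι₁ ∈ Φ.1) (μ : Literature.NumberTheory.Automorphic.IdeleClassGroup (F : Type) →ₜ* Circle)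
      (hμ : IdeleClassGroup.IsConjugateSymplectic (F : Type) μ) (hw : IdeleClassGroup.HasWeight (F : Type) μ 1),
      Def411AsPrinted (toThm418Data _ (restOfCharDeltaPrime (Summit.HodgeConjecture.CorCM.DelRec.exists_recordSystem_of_printed hDel) ⟨HodgeCM.CMField.K F⟩ h6 ι₁ ⟨HodgeCM.HermSpace3.Hm V, HodgeCM.HermSpace3.isHermitian V, HodgeCM.HermSpace3.signature_ι₁ V, HodgeCM.HermSpace3.posDef_of_ne V⟩ Φ e₁ (frameD V) (frameD_real V) (frameD_ne V) (ιVE V) (Rep.update ↥(maximalRealSubfield (HodgeCM.CMField.K F)) (imagUnitSq (HodgeCM.CMField.K F)) (Rep.ofLineOf ↥(maximalRealSubfield (HodgeCM.CMField.K F)) (imagUnitSq (HodgeCM.CMField.K F))) (locF ↥(maximalRealSubfield (HodgeCM.CMField.K F)) (imagUnitSq (HodgeCM.CMField.K F)) (realUnit ⟨HodgeCM.CMField.K F⟩ a.1 a.2.1 a.2.2)) (realUnit ⟨HodgeCM.CMField.K F⟩ a.1 a.2.1 a.2.2) rfl) μ hμ hw)))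
    (h413 : ∀ (F : HodgeCM.CMField) [IsGalois ℚ F] (h6 : 6 ≤ Module.finrank ℚ F) {ι₁ : F →+* ℂ} (V : HodgeCM.HermSpace3 F ι₁) (a₀ : RealScalar F)
      (Φ : CMType F) (hΦ : ι₁ ∈ Φ.1) (i : (I V (repAt a₀) (muLiu ι₁ GramClass.rep))), Prop413AsPrinted (((uniformOmegaRep (Summit.HodgeConjecture.CorCM.DelRec.exists_recordSystem_of_printed hDel) ⟨HodgeCM.CMField.K F⟩ ι₁ ⟨HodgeCM.HermSpace3.Hm V, HodgeCM.HermSpace3.isHermitian V, HodgeCM.HermSpace3.signature_ι₁ V, HodgeCM.HermSpace3.posDef_of_ne V⟩ Φ e₁ (frameD V) (frameD_real V) (frameD_ne V) (ιVE V) (2 * imagUnit (HodgeCM.CMField.K F))⁻¹ (fun _ _ => (Rep.update ↥(maximalRealSubfield (HodgeCM.CMField.K F)) (imagUnitSq (HodgeCM.CMField.K F)) (Rep.ofLineOf ↥(maximalRealSubfield (HodgeCM.CMField.K F)) (imagUnitSq (HodgeCM.CMField.K F))) (locF ↥(maximalRealSubfield (HodgeCM.CMField.K F)) (imagUnitSq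 (HodgeCM.CMField.K F)) (realUnit ⟨HodgeCM.CMField.K F⟩ (repAt a₀ (Sigma.fst i)).1 (repAt a₀ (Sigma.fst i)).2.1 (repAt a₀ (Sigma.fst i)).2.2)) (realUnit ⟨HodgeCM.CMField.K F⟩ (repAt a₀ (Sigma.fst i)).1 (repAt a₀ (Sigma.fst i)).2.1 (repAt a₀ (Sigma.fst i)).2.2) rfl)))).prop413Data ((liuDictionaryPin exists_isReal_hodgeModel_holds hodgePQ_independent_of_hodgeModel_holds BallQuotient.ballQuotientUniformised_holds (cmAbelianVarietyRealised_of_eigenbasis exists_isReal_hodgeModel_holds hodgePQ_independent_of_hodgeModel_holds cmAbelianVarietyEigenbasisRealised_holds) Literature.NumberTheory.Transcendental.arapura2012_cor_15_4_6_holds V (I V (repAt a₀) (muLiu ι₁ GramClass.rep)) (line V (repAt a₀) (muLiu ι₁ GramClass.rep)))).H))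
    (hμsep : ∀ (F : HodgeCM.CMField) [IsGalois ℚ F] (h6 : 6 ≤ Module.finrank ℚ F) {ι₁ : F →+* ℂ} (V : HodgeCM.HermSpace3 F ι₁) (a₀ : RealScalar F)
      (Φ : CMType F) (hΦ : ι₁ ∈ Φ.1) (i : (I V (repAt a₀) (muLiu ι₁ GramClass.rep))) (s t : (((uniformOmegaRep (Summit.HodgeConjecture.CorCM.DelRec.exists_recordSystem_of_printed hDel) ⟨HodgeCM.CMField.K F⟩ ι₁ ⟨HodgeCM.HermSpace3.Hm V, HodgeCM.HermSpace3.isHermitian V, HodgeCM.HermSpace3.signature_ι₁ V, HodgeCM.HermSpace3.posDef_of_ne V⟩ Φ e₁ (frameD V) (frameD_real V) (frameD_ne V) (ιVE V) (2 * imagUnit (HodgeCM.CMField.K F))⁻¹ (fun _ _ => (Rep.update ↥(maximalRealSubfield (HodgeCM.CMField.K F)) (imagUnitSq (HodgeCM.CMField.K F)) (Rep.ofLineOf ↥(maximalRealSubfield (HodgeCM.CMField.K F)) (imagUnitSq (HodgeCM.CMField.K F))) (locF ↥(maximalRealSubfield (HodgeCM.CMField.K F)) (imagUnitSq (HodgeCM.CMField.K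 F)) (realUnit ⟨HodgeCM.CMField.K F⟩ (repAt a₀ (Sigma.fst i)).1 (repAt a₀ (Sigma.fst i)).2.1 (repAt a₀ (Sigma.fst i)).2.2)) (realUnit ⟨HodgeCM.CMField.K F⟩ (repAt a₀ (Sigma.fst i)).1 (repAt a₀ (Sigma.fst i)).2.1 (repAt a₀ (Sigma.fst i)).2.2) rfl)))).prop413Data ((liuDictionaryPin exists_isReal_hodgeModel_holds hodgePQ_independent_of_hodgeModel_holds BallQuotient.ballQuotientUniformised_holds (cmAbelianVarietyRealised_of_eigenbasis exists_isReal_hodgeModel_holds hodgePQ_independent_of_hodgeModel_holds cmAbelianVarietyEigenbasisRealised_holds) Literature.NumberTheory.Transcendental.arapura2012_cor_15_4_6_holds V (I V (repAt a₀) (muLiu ι₁ GramClass.rep)) (line V (repAt a₀) (muLiu ι₁ GramClass.rep)))).H).AdmTriple), Nontrivial ((((uniformOmegaRep (Summit.HodgeConjecture.CorCM.DelRec.exists_recordSystem_of_printed hDel) ⟨HodgeCM.CMField.K F⟩ ι₁ ⟨HodgeCM.HermSpace3.Hm V, HodgeCM.HermSpace3.isHermitian V, HodgeCM.HermSpace3.signature_ι₁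 V, HodgeCM.HermSpace3.posDef_of_ne V⟩ Φ e₁ (frameD V) (frameD_real V) (frameD_ne V) (ιVE V) (2 * imagUnit (HodgeCM.CMField.K F))⁻¹ (fun _ _ => (Rep.update ↥(maximalRealSubfield (HodgeCM.CMField.K F)) (imagUnitSq (HodgeCM.CMField.K F)) (Rep.ofLineOf ↥(maximalRealSubfield (HodgeCM.CMField.K F)) (imagUnitSq (HodgeCM.CMField.K F))) (locF ↥(maximalRealSubfield (HodgeCM.CMField.K F)) (imagUnitSq (HodgeCM.CMField.K F)) (realUnit ⟨HodgeCM.CMField.K F⟩ (repAt a₀ (Sigma.fst i)).1 (repAt a₀ (Sigma.fst i)).2.1 (repAt a₀ (Sigma.fst i)).2.2)) (realUnit ⟨HodgeCM.CMField.K F⟩ (repAt a₀ (Sigma.fst i)).1 (repAt a₀ (Sigma.fst i)).2.1 (repAt a₀ (Sigma.fst i)).2.2) rfl)))).prop413Data ((liuDictionaryPin exists_isReal_hodgeModel_holds hodgePQ_independent_of_hodgeModel_holds BallQuotient.ballQuotientUniformised_holds (cmAbelianVarietyRealised_of_eigenbasis exists_isReal_hodgeModel_holds hodgePQ_independent_of_hodgeModel_holds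 cmAbelianVarietyEigenbasisRealised_holds) Literature.NumberTheory.Transcendental.arapura2012_cor_15_4_6_holds V (I V (repAt a₀) (muLiu ι₁ GramClass.rep)) (line V (repAt a₀) (muLiu ι₁ GramClass.rep)))).H).omegaAt s) →
      (∃ f : (((uniformOmegaRep (Summit.HodgeConjecture.CorCM.DelRec.exists_recordSystem_of_printed hDel) ⟨HodgeCM.CMField.K F⟩ ι₁ ⟨HodgeCM.HermSpace3.Hm V, HodgeCM.HermSpace3.isHermitian V, HodgeCM.HermSpace3.signature_ι₁ V, HodgeCM.HermSpace3.posDef_of_ne V⟩ Φ e₁ (frameD V) (frameD_real V) (frameD_ne V) (ιVE V) (2 * imagUnit (HodgeCM.CMField.K F))⁻¹ (fun _ _ => (Rep.update ↥(maximalRealSubfield (HodgeCM.CMField.K F)) (imagUnitSq (HodgeCM.CMField.K F)) (Rep.ofLineOf ↥(maximalRealSubfield (HodgeCM.CMField.K F)) (imagUnitSq (HodgeCM.CMField.K F))) (locF ↥(maximalRealSubfield (HodgeCM.CMField.K F)) (imagUnitSq (HodgeCM.CMField.K F)) (realUnit ⟨HodgeCM.CMField.K F⟩ (repAt a₀ (Sigma.fst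 i)).1 (repAt a₀ (Sigma.fst i)).2.1 (repAt a₀ (Sigma.fst i)).2.2)) (realUnit ⟨HodgeCM.CMField.K F⟩ (repAt a₀ (Sigma.fst i)).1 (repAt a₀ (Sigma.fst i)).2.1 (repAt a₀ (Sigma.fst i)).2.2) rfl)))).prop413Data ((liuDictionaryPin exists_isReal_hodgeModel_holds hodgePQ_independent_of_hodgeModel_holds BallQuotient.ballQuotientUniformised_holds (cmAbelianVarietyRealised_of_eigenbasis exists_isReal_hodgeModel_holds hodgePQ_independent_of_hodgeModel_holds cmAbelianVarietyEigenbasisRealised_holds) Literature.NumberTheory.Transcendental.arapura2012_cor_15_4_6_holds V (I V (repAt a₀) (muLiu ι₁ GramClass.rep)) (line V (repAt a₀) (muLiu ι₁ GramClass.rep)))).H).omegaAt s ≃ₗ[ℂ] (((uniformOmegaRep (Summit.HodgeConjecture.CorCM.DelRec.exists_recordSystem_of_printed hDel) ⟨HodgeCM.CMField.K F⟩ ι₁ ⟨HodgeCM.HermSpace3.Hm V, HodgeCM.HermSpace3.isHermitian V, HodgeCM.HermSpace3.signature_ι₁ V, HodgeCM.HermSpace3.posDef_of_ne V⟩ Φ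 e₁ (frameD V) (frameD_real V) (frameD_ne V) (ιVE V) (2 * imagUnit (HodgeCM.CMField.K F))⁻¹ (fun _ _ => (Rep.update ↥(maximalRealSubfield (HodgeCM.CMField.K F)) (imagUnitSq (HodgeCM.CMField.K F)) (Rep.ofLineOf ↥(maximalRealSubfield (HodgeCM.CMField.K F)) (imagUnitSq (HodgeCM.CMField.K F))) (locF ↥(maximalRealSubfield (HodgeCM.CMField.K F)) (imagUnitSq (HodgeCM.CMField.K F)) (realUnit ⟨HodgeCM.CMField.K F⟩ (repAt a₀ (Sigma.fst i)).1 (repAt a₀ (Sigma.fst i)).2.1 (repAt a₀ (Sigma.fst i)).2.2)) (realUnit ⟨HodgeCM.CMField.K F⟩ (repAt a₀ (Sigma.fst i)).1 (repAt a₀ (Sigma.fst i)).2.1 (repAt a₀ (Sigma.fst i)).2.2) rfl)))).prop413Data ((liuDictionaryPin exists_isReal_hodgeModel_holds hodgePQ_independent_of_hodgeModel_holds BallQuotient.ballQuotientUniformised_holds (cmAbelianVarietyRealised_of_eigenbasis exists_isReal_hodgeModel_holds hodgePQ_independent_of_hodgeModel_holds cmAbelianVarietyEigenbasisRealised_holds)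 Literature.NumberTheory.Transcendental.arapura2012_cor_15_4_6_holds V (I V (repAt a₀) (muLiu ι₁ GramClass.rep)) (line V (repAt a₀) (muLiu ι₁ GramClass.rep)))).H).omegaAt t,
        ∀ (g : ↥V.adelicFin) (v : (((uniformOmegaRep (Summit.HodgeConjecture.CorCM.DelRec.exists_recordSystem_of_printed hDel) ⟨HodgeCM.CMField.K F⟩ ι₁ ⟨HodgeCM.HermSpace3.Hm V, HodgeCM.HermSpace3.isHermitian V, HodgeCM.HermSpace3.signature_ι₁ V, HodgeCM.HermSpace3.posDef_of_ne V⟩ Φ e₁ (frameD V) (frameD_real V) (frameD_ne V) (ιVE V) (2 * imagUnit (HodgeCM.CMField.K F))⁻¹ (fun _ _ => (Rep.update ↥(maximalRealSubfield (HodgeCM.CMField.K F)) (imagUnitSq (HodgeCM.CMField.K F)) (Rep.ofLineOf ↥(maximalRealSubfield (HodgeCM.CMField.K F)) (imagUnitSq (HodgeCM.CMField.K F))) (locF ↥(maximalRealSubfield (HodgeCM.CMField.K F)) (imagUnitSq (HodgeCM.CMField.K F)) (realUnit ⟨HodgeCM.CMField.K F⟩ (repAt a₀ (Sigma.fst i)).1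 (repAt a₀ (Sigma.fst i)).2.1 (repAt a₀ (Sigma.fst i)).2.2)) (realUnit ⟨HodgeCM.CMField.K F⟩ (repAt a₀ (Sigma.fst i)).1 (repAt a₀ (Sigma.fst i)).2.1 (repAt a₀ (Sigma.fst i)).2.2) rfl)))).prop413Data ((liuDictionaryPin exists_isReal_hodgeModel_holds hodgePQ_independent_of_hodgeModel_holds BallQuotient.ballQuotientUniformised_holds (cmAbelianVarietyRealised_of_eigenbasis exists_isReal_hodgeModel_holds hodgePQ_independent_of_hodgeModel_holds cmAbelianVarietyEigenbasisRealised_holds) Literature.NumberTheory.Transcendental.arapura2012_cor_15_4_6_holds V (I V (repAt a₀) (muLiu ι₁ GramClass.rep)) (line V (repAt a₀) (muLiu ι₁ GramClass.rep)))).H).omegaAt s), f ((((uniformOmegaRep (Summit.HodgeConjecture.CorCM.DelRec.exists_recordSystem_of_printed hDel) ⟨HodgeCM.CMField.K F⟩ ι₁ ⟨HodgeCM.HermSpace3.Hm V, HodgeCM.HermSpace3.isHermitian V, HodgeCM.HermSpace3.signature_ι₁ V, HodgeCM.HermSpace3.posDef_of_ne V⟩ Φ e₁ (frameD V) (frameD_real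 V) (frameD_ne V) (ιVE V) (2 * imagUnit (HodgeCM.CMField.K F))⁻¹ (fun _ _ => (Rep.update ↥(maximalRealSubfield (HodgeCM.CMField.K F)) (imagUnitSq (HodgeCM.CMField.K F)) (Rep.ofLineOf ↥(maximalRealSubfield (HodgeCM.CMField.K F)) (imagUnitSq (HodgeCM.CMField.K F))) (locF ↥(maximalRealSubfield (HodgeCM.CMField.K F)) (imagUnitSq (HodgeCM.CMField.K F)) (realUnit ⟨HodgeCM.CMField.K F⟩ (repAt a₀ (Sigma.fst i)).1 (repAt a₀ (Sigma.fst i)).2.1 (repAt a₀ (Sigma.fst i)).2.2)) (realUnit ⟨HodgeCM.CMField.K F⟩ (repAt a₀ (Sigma.fst i)).1 (repAt a₀ (Sigma.fst i)).2.1 (repAt a₀ (Sigma.fst i)).2.2) rfl)))).prop413Data ((liuDictionaryPin exists_isReal_hodgeModel_holds hodgePQ_independent_of_hodgeModel_holds BallQuotient.ballQuotientUniformised_holds (cmAbelianVarietyRealised_of_eigenbasis exists_isReal_hodgeModel_holds hodgePQ_independent_of_hodgeModel_holds cmAbelianVarietyEigenbasisRealised_holds) Literature.NumberTheory.Transcendental.arapura2012_cor_15_4_6_holds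 V (I V (repAt a₀) (muLiu ι₁ GramClass.rep)) (line V (repAt a₀) (muLiu ι₁ GramClass.rep)))).H).rhoAt s g v) = (((uniformOmegaRep (Summit.HodgeConjecture.CorCM.DelRec.exists_recordSystem_of_printed hDel) ⟨HodgeCM.CMField.K F⟩ ι₁ ⟨HodgeCM.HermSpace3.Hm V, HodgeCM.HermSpace3.isHermitian V, HodgeCM.HermSpace3.signature_ι₁ V, HodgeCM.HermSpace3.posDef_of_ne V⟩ Φ e₁ (frameD V) (frameD_real V) (frameD_ne V) (ιVE V) (2 * imagUnit (HodgeCM.CMField.K F))⁻¹ (fun _ _ => (Rep.update ↥(maximalRealSubfield (HodgeCM.CMField.K F)) (imagUnitSq (HodgeCM.CMField.K F)) (Rep.ofLineOf ↥(maximalRealSubfield (HodgeCM.CMField.K F)) (imagUnitSq (HodgeCM.CMField.K F))) (locF ↥(maximalRealSubfield (HodgeCM.CMField.K F)) (imagUnitSq (HodgeCM.CMField.K F)) (realUnit ⟨HodgeCM.CMField.K F⟩ (repAt a₀ (Sigma.fst i)).1 (repAt a₀ (Sigma.fst i)).2.1 (repAt a₀ (Sigma.fst i)).2.2)) (realUnit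 ⟨HodgeCM.CMField.K F⟩ (repAt a₀ (Sigma.fst i)).1 (repAt a₀ (Sigma.fst i)).2.1 (repAt a₀ (Sigma.fst i)).2.2) rfl)))).prop413Data ((liuDictionaryPin exists_isReal_hodgeModel_holds hodgePQ_independent_of_hodgeModel_holds BallQuotient.ballQuotientUniformised_holds (cmAbelianVarietyRealised_of_eigenbasis exists_isReal_hodgeModel_holds hodgePQ_independent_of_hodgeModel_holds cmAbelianVarietyEigenbasisRealised_holds) Literature.NumberTheory.Transcendental.arapura2012_cor_15_4_6_holds V (I V (repAt a₀) (muLiu ι₁ GramClass.rep)) (line V (repAt a₀) (muLiu ι₁ GramClass.rep)))).H).rhoAt t g (f v)) → s.1.μ = t.1.μ)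
    (hD1'' : ∀ (F : HodgeCM.CMField) [IsGalois ℚ F] (h6 : 6 ≤ Module.finrank ℚ F) {ι₁ : F →+* ℂ} (V : HodgeCM.HermSpace3 F ι₁) (a : RealScalar F)
      (Φ : CMType F) (hΦ : ι₁ ∈ Φ.1) (μ : Literature.NumberTheory.Automorphic.IdeleClassGroup (F : Type) →ₜ* Circle)
      (hμ : IdeleClassGroup.IsConjugateSymplectic (F : Type) μ) (hw : IdeleClassGroup.HasWeight (F : Type) μ 1)
      (j : (toThm418Data _ (restOfCharDeltaPrime (Summit.HodgeConjecture.CorCM.DelRec.exists_recordSystem_of_printed hDel) ⟨HodgeCM.CMField.K F⟩ h6 ι₁ ⟨HodgeCM.HermSpace3.Hm V, HodgeCM.HermSpace3.isHermitian V, HodgeCM.HermSpace3.signature_ι₁ V, HodgeCM.HermSpace3.posDef_of_ne V⟩ Φ e₁ (frameD V) (frameD_real V) (frameD_ne V) (ιVE V) (Rep.update ↥(maximalRealSubfield (HodgeCM.CMField.K F)) (imagUnitSq (HodgeCM.CMField.K F)) (Rep.ofLineOf ↥(maximalRealSubfield (HodgeCM.CMField.K F)) (imagUnitSq (HodgeCM.CMField.K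 F))) (locF ↥(maximalRealSubfield (HodgeCM.CMField.K F)) (imagUnitSq (HodgeCM.CMField.K F)) (realUnit ⟨HodgeCM.CMField.K F⟩ a.1 a.2.1 a.2.2)) (realUnit ⟨HodgeCM.CMField.K F⟩ a.1 a.2.1 a.2.2) rfl) μ hμ hw)).AdmIndex) (v : IsDedekindDomain.HeightOneSpectrum (𝓞 ↥(maximalRealSubfield (F : Type)))),
      LemD1_1AsPrinted
        (Def411WeilCarriers.localLemD1Data ↥(maximalRealSubfield (F : Type)) (F : Type) (IsCMField.complexConj (F : Type)) 3 e₁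
          (Matrix.diagonal (frameD V)) (complexConj_imagUnit (F : Type)) (imagUnit_ne_zero (F : Type)) (imagUnit_mul_self (F : Type))
          (realDiagonal_isSymm (F : Type) (frameD V) (frameD_real V)) (isUnit_det_realDiagonal (F : Type) (frameD V) (frameD_real V) (frameD_ne V))
          (realDiagonal_map (F : Type) (frameD V) (frameD_real V)).symm (((Rep.update ↥(maximalRealSubfield (HodgeCM.CMField.K F)) (imagUnitSq (HodgeCM.CMField.K F)) (Rep.ofLineOf ↥(maximalRealSubfield (HodgeCM.CMField.K F)) (imagUnitSq (HodgeCM.CMField.K F))) (locF ↥(maximalRealSubfield (HodgeCM.CMField.K F)) (imagUnitSq (HodgeCM.CMField.K F)) (realUnit ⟨HodgeCM.CMField.K F⟩ a.1 a.2.1 a.2.2)) (realUnit ⟨HodgeCM.CMField.K F⟩ a.1 a.2.1 a.2.2) rfl)).toFun j.1.1)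
          (OmegaChiSplitting.chiLocalSplittingsD ⟨HodgeCM.CMField.K F⟩ e₁ (frameD V) (frameD_real V) (frameD_ne V) (toHeckeCharacter (F : Type) μ)
            ((isOscillatorChar_toHeckeCharacter_iff μ).mpr hμ) (((Rep.update ↥(maximalRealSubfield (HodgeCM.CMField.K F)) (imagUnitSq (HodgeCM.CMField.K F)) (Rep.ofLineOf ↥(maximalRealSubfield (HodgeCM.CMField.K F)) (imagUnitSq (HodgeCM.CMField.K F))) (locF ↥(maximalRealSubfield (HodgeCM.CMField.K F)) (imagUnitSq (HodgeCM.CMField.K F)) (realUnit ⟨HodgeCM.CMField.K F⟩ a.1 a.2.1 a.2.2)) (realUnit ⟨HodgeCM.CMField.K F⟩ a.1 a.2.1 a.2.2) rfl)).toFun j.1.1))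
          (le_refl 3) (localMu (F : Type) (toHeckeCharacter (F : Type) μ))
          (fun v x => norm_localMu (F : Type) (toHeckeCharacter (F : Type) μ) v (isUnitary_toHeckeCharacter (F : Type) μ) x)
          (continuous_localMu (F : Type) (toHeckeCharacter (F : Type) μ))
          (fun v t => localMu_toLocalRing_eq_one_iff (F : Type) (toHeckeCharacter (F : Type) μ) v ((isOscillatorChar_toHeckeCharacter_iff μ).mpr hμ) t)
          j.1.2.1
          (Def411WeilCarriers.norm_chi_eq_one ↥(maximalRealSubfield (F : Type)) (F : Type) (IsCMField.complexConj (F : Type))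
            (Algebra.IsQuadraticExtension.finrank_eq_two ↥(maximalRealSubfield (F : Type)) (F : Type))
            (UnitaryGroup.algEquiv_ne_one_of_apply_eq_neg ↥(maximalRealSubfield (F : Type)) (F : Type) (IsCMField.complexConj (F : Type))
              (complexConj_imagUnit (F : Type)) (imagUnit_ne_zero (F : Type))) j.1.2)
          j.1.2.2.1 v))
    : HC_CM :=
  Summit.HodgeConjecture.CorCM.D2Bridge.MuKeyIdentEnd.hc_cm_of_printed_citations_muKey_ident
    (Summit.HodgeConjecture.CorCM.DelRec.exists_recordSystem_of_printed hDel) h21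
    (fun F hG h6 {ι₁} V a Φ hΦ ν hν hw => by
      haveI : IsGalois ℚ F := hG
      -- the identification binder DISCHARGED IN KERNEL: RSCONJ row R6 over `Model.RecordSystemConj.exists_conj` (module `HComp.RecordSystemConj`)
      obtain ⟨R', hR'⟩ :=
        Summit.HodgeConjecture.CorCM.D2Bridge.MuConjIdent.exists_recordSystemConj_X_sec42DataOf_levelOf_eq
          (Summit.HodgeConjecture.CorCM.DelRec.exists_recordSystem_of_printed hDel)
          (⟨HodgeCM.HermSpace3.Hm V, HodgeCM.HermSpace3.isHermitian V, HodgeCM.HermSpace3.signature_ι₁ V, HodgeCM.HermSpace3.posDef_of_ne V⟩ : Summit.HodgeConjecture.CorCM.HermSpace3 ⟨HodgeCM.CMField.K F⟩ ι₁) Φ isoOf h6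
      exact hLiu418 F h6 V a Φ hΦ ν hν hw R' hR')
    h411 h413 hμsep hD1''

end Summit.HodgeConjecture.CorCM.D2Bridge.MuKeyIdentEndDelRecConj

end
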